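import Summits.BirchSwinnertonDyer.BirchSwinnertonDyer.Theses.PlecticLegs
import Literature.NumberTheory.EllipticCurves.Selmer
import Literature.NumberTheory.EllipticCurves.GaloisAction
import Literature.NumberTheory.EllipticCurves.SelmerCorankHolds
import Literature.NumberTheory.EllipticCurves.BSDSha
import Literature.NumberTheory.EllipticCurves.BSDSelmerParityDokchitserProofs
import Literature.NumberTheory.EllipticCurves.AdmissiblePrimeSupply
import HarnessLib

/-!
# Crux `PlecticLegs.PlecticPointsLB` (stmt-BirchSwinnertonDyer-17518), line `Sketch`, stub D `stub_points` —
# the wall stub from `ShaFiniteConjectureNF` alone, the admissible-prime SUPPLY discharged (rev 2, 2026-08-17)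

Successor of `Lines/Sketch_stub_points.lean`, whose `stub_points_of_shaFinite_of_admissibleSupply` proved
the registered stub D

  `∀ F (totally real) V, 2 ≤ [F:ℚ] → r_an(V/F) = [F:ℚ] → ∃ p admissible, corank Sel_{p^∞}(V/F) ≤ rank V(F)`

from (i) `Literature.NumberTheory.EllipticCurves.ShaFiniteConjectureNF K` for totally real `K`
(Tate 1974, Conj. 1 — the EXISTING open conjecture decl) and (ii) an explicit hypothesis `hSupply`:
every elliptic curve over a totally real field has an admissible prime (`5 ≤ p`, `p ∤ disc F`,
`ρ̄_{V,p}` irreducible, good ordinary above `p`). Hypothesis (ii) is now a consequence of the tree: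

* `E[p]` is irreducible for all but finitely many `p` over a totally real field — THEOREM
  `WeierstrassCurve.finite_setOf_not_hasIrreducibleModPGaloisRep_of_isTotallyReal`
  (`Literature/NumberTheory/EllipticCurves/IsogenyNotRationalCMRealProofs.lean`, p166956: Silverman
  *AEC* Cor. IX.6.3 via Shafarevich, with `End_F(E) = ℤ` for `F` real, Silverman *AT* Thm. II.2.2(a));
* everywhere good ordinary reduction above infinitely many `p` — NAMED FACT
  `Literature.NumberTheory.EllipticCurves.infinite_setOf_prime_goodOrdinaryAbove`
  (`Literature/NumberTheory/EllipticCurves/AdmissiblePrimeSupply.lean`, p167238: corollary of Serre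
  1981 §8.2 Thm. 20 / Remarque 2 + §2.1 Thm. 1 and, for CM curves, Deuring–Lang Ch. 13 §4 Thm. 12);
* whence the supply `Literature.NumberTheory.EllipticCurves.exists_admissiblePrime` (proved there:
  `p ∤ disc F ≠ 0` and `p ≥ 5` exclude finitely many more primes).

So D reduces to `ShaFiniteConjectureNF` over totally real fields plus ONE named fact, both honest
named hypotheses (no ad-hoc supply hypothesis): `stub_points_of_shaFinite_of_goodOrdinaryAbove`. The
plectic-regime hypotheses `2 ≤ d`, `r_an = d` remain unused — D is the Selmer-versus-Mordell–Weil
wall, independent of the analytic regime (cf. the predecessor's module docstring).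
-/

set_option linter.dupNamespace false -- single-conjunct summit: Sub = Summit (D-0017)

open NumberField IsDedekindDomain

namespace Summit.BirchSwinnertonDyer.BirchSwinnertonDyer.Theorems

open Literature.NumberTheory.EllipticCurves

/-- If `Ш(V/K)` is finite then `corank_{ℤ_p} Sel_{p^∞}(V/K) ≤ rank_ℤ V(K)` (indeed `=`) at every prime `p`:
`s_p = rank + corank Ш[p^∞]` (`selmerCorank_eq_mordellWeilRank_add_holds`) and a finite group has `ℤ_p`-corank `0`
(`zpCorank_eq_zero_of_finite`, applied to the `p`-primary component of `Ш`). (Same statement and proof as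
`selmerCorank_le_mordellWeilRank_of_finite_sha` of `Lines/Sketch_stub_points.lean`, renamed to keep the two
line files jointly importable.) -/
theorem selmerCorank_le_mordellWeilRank_of_finite_sha' {K : Type} [Field K] [NumberField K]
    (V : WeierstrassCurve K) [V.IsElliptic] (hfin : Finite V.sha) (p : ℕ) [Fact p.Prime] :
    V.selmerCorank p ≤ V.mordellWeilRank := by
  haveI : Finite (AddCommGroup.primaryComponent V.sha p) := Subtype.finite
  have h0 : V.shaCorank p = 0 := zpCorank_eq_zero_of_finite _ p
  have hs := V.selmerCorank_eq_mordellWeilRank_add_holds p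
  omega

/-- **Stub D from Ш-finiteness and the good-ordinary supply fact.** If `Ш(V/F)` is finite for every
elliptic curve over every totally real number field (`ShaFiniteConjectureNF`, Tate 1974 Conj. 1 — an open
conjecture, taken as a hypothesis) and every elliptic curve over a number field has everywhere good ordinary
reduction above infinitely many primes (`infinite_setOf_prime_goodOrdinaryAbove`, Serre 1981 / Deuring — a
named fact), then the registered stub `stub_points` holds: the admissible prime is supplied by
`exists_admissiblePrime` (irreducibility of `E[p]` for almost all `p` being a theorem over totally real
fields), and `s_p ≤ rank` at it by `selmerCorank_le_mordellWeilRank_of_finite_sha'`. The plectic-regime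
hypotheses are unused. -/
theorem stub_points_of_shaFinite_of_goodOrdinaryAbove
    (hSha : ∀ (K : Type) [Field K] [NumberField K], NumberField.IsTotallyReal K → ShaFiniteConjectureNF K)
    (hOrd : infinite_setOf_prime_goodOrdinaryAbove) :
    ∀ (F : Type) [Field F] [NumberField F] [NumberField.IsTotallyReal F] (V : WeierstrassCurve F)
      [V.IsElliptic], 2 ≤ Module.finrank ℚ F → V.analyticRank = Module.finrank ℚ F →
      ∃ (p : ℕ) (_ : Fact p.Prime), 5 ≤ p ∧ ¬ ((p : ℤ) ∣ NumberField.discr F) ∧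
        V.HasIrreducibleModPGaloisRep p ∧
        (∀ 𝔭 : HeightOneSpectrum (𝓞 F), (p : 𝓞 F) ∈ 𝔭.asIdeal →
          ((V.baseChange (𝔭.adicCompletion F)).localPolynomial (𝔭.adicCompletionIntegers F)).natDegree = 2 ∧
          ¬ (p : ℤ) ∣ ((V.baseChange (𝔭.adicCompletion F)).localPolynomial
            (𝔭.adicCompletionIntegers F)).coeff 1) ∧
        V.selmerCorank p ≤ V.mordellWeilRank := by
  intro F _ _ hF V hV _ _
  obtain ⟨p, hp, h5, hdisc, hirr, hord⟩ := exists_admissiblePrime hOrd F V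
  haveI := hp
  exact ⟨p, hp, h5, hdisc, hirr, hord,
    selmerCorank_le_mordellWeilRank_of_finite_sha' V (hSha F hF V hV) p⟩

/-- **What remains of stub D after the supply is discharged** (bookkeeping form): the registered stub
follows from `Ш`-finiteness over totally real fields ALONE once `infinite_setOf_prime_goodOrdinaryAbove` is
granted — equivalently, modulo that printed fact, D is implied by (and is the `p`-adic shadow of)
`ShaFiniteConjectureNF` in the plectic regime. Stated as an implication between the two closed `Prop`s. -/
theorem stub_points_of_shaFinite (hOrd : infinite_setOf_prime_goodOrdinaryAbove) :
    (∀ (K : Type) [Field K] [NumberField K], NumberField.IsTotallyReal K → ShaFiniteConjectureNF K) →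
    ∀ (F : Type) [Field F] [NumberField F] [NumberField.IsTotallyReal F] (V : WeierstrassCurve F)
      [V.IsElliptic], 2 ≤ Module.finrank ℚ F → V.analyticRank = Module.finrank ℚ F →
      ∃ (p : ℕ) (_ : Fact p.Prime), 5 ≤ p ∧ ¬ ((p : ℤ) ∣ NumberField.discr F) ∧
        V.HasIrreducibleModPGaloisRep p ∧
        (∀ 𝔭 : HeightOneSpectrum (𝓞 F), (p : 𝓞 F) ∈ 𝔭.asIdeal →
          ((V.baseChange (𝔭.adicCompletion F)).localPolynomial (𝔭.adicCompletionIntegers F)).natDegree = 2 ∧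
          ¬ (p : ℤ) ∣ ((V.baseChange (𝔭.adicCompletion F)).localPolynomial
            (𝔭.adicCompletionIntegers F)).coeff 1) ∧
        V.selmerCorank p ≤ V.mordellWeilRank :=
  fun hSha ↦ stub_points_of_shaFinite_of_goodOrdinaryAbove hSha hOrd

end Summit.BirchSwinnertonDyer.BirchSwinnertonDyer.Theorems
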